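import Mathlib
import Summits.NavierStokesRegularity.NavierStokesRegularity.Theorems.DssFarFieldSlavingBlowupTypeIDssProfileGaussianGapTypeI
import Summits.NavierStokesRegularity.NavierStokesRegularity.Theorems.DssFarFieldSlavingBlowupTypeIDssProfileSmoothRepresentativeAe
import HarnessLib

/-!
# The Gaussian-gap cell E32 is EMPTY at CLASS level (pub-ns-dss theory T41, `GaussianGapClassSim`;
  route `DssFarFieldSlaving`, crux `BlowupTypeIDssProfile`, stmt-NavierStokesRegularity-0155 — SUPPORT;
  cell pub-ns-dss, typer seat g4, 2026-08-23; lead A129 precision 9; imports the classical file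
  `…GaussianGapTypeI.lean` and the smooth-representative file)

HONEST FRAMING. A Liouville statement for a SLICE of the hypothesis class of
`Theses.FilamentSkeletonRss.RdssProfileTruncation` (H0 `1 < c`, H5 ancient mild, H4 measurable
slices, H2 `(c, R)`-RDSS, H3 `HasTypeIDecay M u`, H6 non-trivial) under the explicit perturbative
budget `Λ + ¼P₋ + ½μ₀ < 3/2` imposed on every Type-I smooth representative `V` (`IsTypeIAncientMild M V`,
`V t =ᵐ u t`; one exists by `typeI_ancient_smoothRepresentative_ae`) through its similarity-variable
velocity `lerayOrbit V` and vorticity `lerayVorticity V` — an empty slice is a census ghost index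
(C13 D-6), never a discard; nothing here bears on Navier–Stokes regularity. DERIVED by the cell's theory
seat (EXPLICIT-THRESHOLDS T41 / EMPTY-CELLS E32; red ×2: s14 (phys) + s21 (Sim dictionary)); statement =
the theory seat's `GaussianGapClassSim` (GaussianGapStatements.lean v2 sha256[16] 7d1058abdd5585ce)
binder for binder. No bound on the Gaussian enstrophy is assumed and no RDSS periodicity is used: the
tree's class-uniform scale-invariant gauge bounds make it automatic
(`GaussianGap.typeI_ancient_gaussianGap_eq_zero'`), so the RDSS structure `(c, R)` is not used at all —
the cell is empty already inside the Type-I ancient mild class. [this file; theory T41 / E32]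
-/

noncomputable section

set_option linter.dupNamespace false

namespace Summit.NavierStokesRegularity.NavierStokesRegularity.Theorems.GaussianGap

open Set Function Filter MeasureTheory InnerProductSpace
open scoped RealInnerProductSpace Laplacian ContDiff Topology BigOperators
open Literature.Analysis Literature.Analysis.FluidPDE Literature.Analysis.UnboundedOperators
open Summit.NavierStokesRegularity.NavierStokesRegularity.Theorems

/-- **E32 at CLASS level (T41): the Gaussian-gap slice of the hypothesis class of
`RdssProfileTruncation` is EMPTY.** For every Type-I bound `M` and every budget
`Λ + Pm/4 + μ₀/2 < 3/2` there is no member (any factor `c > 1`, any isometry `R`) all of whose smooth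
Type-I representatives `V` satisfy, in similarity variables (`U = lerayOrbit V`, `Ω = lerayVorticity V`,
`K = heatKernel 1`), the stretching bound `⟪DU[Ω],Ω⟫ ≤ Λ|Ω|²`, the inward-flux bound `−⟪y,U⟫ ≤ Pm`
and the Gaussian-mean bound `|∫KΩ|² ≤ μ₀∫K|Ω|²` for all `s`. Representatives are quantified
universally, as in the E24/E27 wrappers. Proof: `typeI_ancient_smoothRepresentative_ae` +
`typeI_ancient_gaussianGap_eq_zero'`. [this file; theory T41 / E32] -/
theorem rdssClass_gaussianGap_empty (M : ℝ) {Λ Pm μ₀ : ℝ} (hbudget : Λ + Pm / 4 + μ₀ / 2 < 3 / 2) :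
    ¬ ∃ (c : ℝ) (R : (EuclideanSpace ℝ (Fin 3)) ≃ₗᵢ[ℝ] (EuclideanSpace ℝ (Fin 3)))
        (u : ℝ → (EuclideanSpace ℝ (Fin 3)) → (EuclideanSpace ℝ (Fin 3))),
      1 < c ∧ IsAncientMildSolution 1 u ∧ (∀ t < 0, AEStronglyMeasurable (u t) volume) ∧
      IsRotatedDSS c R u ∧ HasTypeIDecay M u ∧
      (∀ V : ℝ → EuclideanSpace ℝ (Fin 3) → EuclideanSpace ℝ (Fin 3), IsTypeIAncientMild M V →
        (∀ t < 0, V t =ᵐ[volume] u t) →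
        (∀ (s : ℝ) (y : EuclideanSpace ℝ (Fin 3)),
          ⟪fderiv ℝ (lerayOrbit V s) y (lerayVorticity V s y), lerayVorticity V s y⟫ ≤
            Λ * ‖lerayVorticity V s y‖ ^ 2) ∧
        (∀ (s : ℝ) (y : EuclideanSpace ℝ (Fin 3)), -⟪y, lerayOrbit V s y⟫ ≤ Pm) ∧
        (∀ s : ℝ,
          ‖∫ y, heatKernel 1 y • lerayVorticity V s y‖ ^ 2 ≤
            μ₀ * ∫ y, heatKernel 1 y * ‖lerayVorticity V s y‖ ^ 2)) ∧
      ¬ (∀ t < 0, u t =ᵐ[volume] 0) := by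
  rintro ⟨c, R, u, -, hmild, hmeas, -, hdec, hcell, hne⟩
  obtain ⟨V, hT, -, hVu, -⟩ := typeI_ancient_smoothRepresentative_ae hmild hmeas hdec
  obtain ⟨hstrain, hflux, hmean⟩ := hcell V hT hVu
  have hz : ∀ t < 0, ∀ x, V t x = 0 :=
    typeI_ancient_gaussianGap_eq_zero' hT hstrain hflux hmean hbudget
  refine hne fun t ht => ?_
  have hVz : V t = 0 := funext fun x => by simpa using hz t ht x
  exact (hVu t ht).symm.trans (Filter.EventuallyEq.of_eq hVz)

/-- **`GaussianGapClassSim` — the theory seat's CLASS-level statement, binder for binder**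
(pub-ns-dss HOME/theory/GaussianGapStatements.lean v2 sha256[16] 7d1058abdd5585ce, `E3` written out).
Proof: `rdssClass_gaussianGap_empty`. [this file; theory T41 / E32] -/
theorem gaussianGapClassSim :
    ∀ (M Λ Pm μ₀ : ℝ), Λ + Pm / 4 + μ₀ / 2 < 3 / 2 →
    ¬ ∃ (c : ℝ) (R : EuclideanSpace ℝ (Fin 3) ≃ₗᵢ[ℝ] EuclideanSpace ℝ (Fin 3))
        (u : ℝ → EuclideanSpace ℝ (Fin 3) → EuclideanSpace ℝ (Fin 3)),
      1 < c ∧ IsAncientMildSolution 1 u ∧ (∀ t < 0, AEStronglyMeasurable (u t) volume) ∧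
      IsRotatedDSS c R u ∧ HasTypeIDecay M u ∧
      (∀ V : ℝ → EuclideanSpace ℝ (Fin 3) → EuclideanSpace ℝ (Fin 3), IsTypeIAncientMild M V →
        (∀ t < 0, V t =ᵐ[volume] u t) →
        (∀ (s : ℝ) (y : EuclideanSpace ℝ (Fin 3)),
          ⟪fderiv ℝ (lerayOrbit V s) y (lerayVorticity V s y), lerayVorticity V s y⟫ ≤
            Λ * ‖lerayVorticity V s y‖ ^ 2) ∧
        (∀ (s : ℝ) (y : EuclideanSpace ℝ (Fin 3)), -⟪y, lerayOrbit V s y⟫ ≤ Pm) ∧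
        (∀ s : ℝ,
          ‖∫ y, heatKernel 1 y • lerayVorticity V s y‖ ^ 2 ≤
            μ₀ * ∫ y, heatKernel 1 y * ‖lerayVorticity V s y‖ ^ 2)) ∧
      ¬ (∀ t < 0, u t =ᵐ[volume] 0) :=
  fun M _ _ _ hbudget => rdssClass_gaussianGap_empty M hbudget

end Summit.NavierStokesRegularity.NavierStokesRegularity.Theorems.GaussianGap

end
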